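import Summits.BirchSwinnertonDyer.BirchSwinnertonDyer.Theses.ShaPrimaryTransfer
import Literature.NumberTheory.EllipticCurves.KubertTate1314FiveIsogeny
import Literature.NumberTheory.EllipticCurves.KubertTate1314RankLe
import Literature.NumberTheory.EllipticCurves.ShaIsogenyTorsionBound
import Literature.NumberTheory.EllipticCurves.IsogenyKummerSequenceProofs
import Literature.NumberTheory.EllipticCurves.IsogenyDualProofs
import Literature.NumberTheory.EllipticCurves.IsogenyMordellWeilRankProofs
import Literature.NumberTheory.EllipticCurves.TwoIsogenyShaTwoTorsion
import Literature.NumberTheory.EllipticCurves.SelmerCorankIsogenyProofs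
import Literature.NumberTheory.EllipticCurves.IsogenyDualKernelCyclotomic
import Literature.NumberTheory.EllipticCurves.KubertTate1314ShaFive
import HarnessLib

/-!
# Route ShaPrimaryTransfer — THE DOOR AT `5` IS OPEN: `t_5(E_{13/14}) = 0` UNCONDITIONALLY; `T` by name at `p₀ = 5`

Helper for item **stmt-BirchSwinnertonDyer-22356** (`FiniteShaComponentTransfer`, «T»); closes nothing by itself; BSD is NOT
proved by this file. The reduction (`t_5 = 0 ⟸ ker Ш(ψ) = ⊥ ⟸ #Sel^ψ(E'/ℚ) ≤ 125`, `#Sel^ψ = 125 · #ker Ш(ψ)`, `ker ψ ≅ μ₅`)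
and the descent itself are Literature theorems (`KubertTate1314ShaFive`: `KubertTate1314Descent.natCard_selmerGroup_dual(_le)`,
`ker_shaMap_dual_eq_bot`, …; generic engine `KubertTateFiveMuDescent`); this file reads them on the route's side for
`E = E_{13/14} = KubertTate1314.curveE = [1, -182, -2548, 0, 0]` (rank `2`, `5` good ordinary anomalous) obtained from the
complete `5`-descent `Literature.….KubertTate1314Descent.shaCorank_five_eq_zero` (tree `KubertTate1314ShaFive`):
`shaCorank_five_curveE_eq_zero` (`t_5 = 0`), `sha_torsionBy_five_curveE_eq_bot`, `selmerCorank_five_curveE_eq_two`,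
`shaCorank_five_curveE'_eq_zero`, **`transfer_at_five : FiniteShaComponentTransfer → ∀ q, t_q(E_{13/14}) = 0`** (`T` BY NAME
at the witness prime `p₀ = 5`), `oneFiniteShaComponent_curveE` (the route's `O`/X1 shape at rank `2`, unconditional), `doorAtFive_open`.

## References

* [SilvermanAEC2009] J. H. Silverman, *AEC*, 2nd ed., Thm. X.4.2, Prop. X.4.9.
* [Fisher2001FiveSevenDescent] T. Fisher, JEMS 3 (2001), §§1–2.
* [MilneADT2006] J. S. Milne, *Arithmetic Duality Theorems*, 2nd ed., Ch. I Lemma 7.1.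
-/

-- D-0017: single-problem summit, so `Summit.BirchSwinnertonDyer.BirchSwinnertonDyer.…` repeats a namespace BY DESIGN.
set_option linter.dupNamespace false
set_option autoImplicit false

noncomputable section

open scoped Classical
open scoped AddSubgroup
open Literature.NumberTheory.EllipticCurves Literature.NumberTheory.EllipticCurves.KubertTate1314
open WeierstrassCurve WeierstrassCurve.Isogeny
open Summit.BirchSwinnertonDyer.BirchSwinnertonDyer.Theses.ShaPrimaryTransfer (FiniteShaComponentTransfer)

namespace Summit.BirchSwinnertonDyer.BirchSwinnertonDyer.Theorems.ShaPrimaryTransferDoorAtFiveDual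

/-! ## The door at `5` is open: `t_5(E_{13/14}) = 0` unconditionally; `T` by name at `p₀ = 5` -/

section Open

/-- Transport of `t_p` along an equality of Weierstrass curves (the `IsElliptic` instances are propositions).
[folklore] -/
private theorem shaCorank_congr {W W' : WeierstrassCurve ℚ} [W.IsElliptic] [W'.IsElliptic] (e : W = W')
    (p : ℕ) : W.shaCorank p = W'.shaCorank p := by
  subst e; rfl

/-- Transport of `s_p` along an equality of Weierstrass curves. [folklore] -/
private theorem selmerCorank_congr {W W' : WeierstrassCurve ℚ} [W.IsElliptic] [W'.IsElliptic] (e : W = W')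
    (p : ℕ) : W.selmerCorank p = W'.selmerCorank p := by
  subst e; rfl

/-- Transport of `Ш[n] = 0` along an equality of Weierstrass curves. [folklore] -/
private theorem sha_torsionBy_eq_bot_congr {W W' : WeierstrassCurve ℚ} [W.IsElliptic] [W'.IsElliptic]
    (e : W = W') (n : ℤ) (h : W'.sha[n] = ⊥) : W.sha[n] = ⊥ := by
  subst e; exact h

/-- Transport of `Ш[p^∞] = 0` along an equality of Weierstrass curves. [folklore] -/
private theorem primaryComponent_sha_eq_bot_congr {W W' : WeierstrassCurve ℚ} [W.IsElliptic] [W'.IsElliptic]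
    (e : W = W') (p : ℕ) (h : AddCommGroup.primaryComponent W'.sha p = ⊥) :
    AddCommGroup.primaryComponent W.sha p = ⊥ := by
  subst e; exact h

/-- **`t_5(E_{13/14}) = corank_{ℤ₅} Ш(E_{13/14}/ℚ)[5^∞] = 0`, UNCONDITIONALLY** — the door at `5` on the
rank-`2` curve `[1, -182, -2548, 0, 0]` (`5` good ordinary anomalous) is open: the full `5`-descent
(`ℤ/5`-side `Sel^φ = 0`, tree g12; `μ₅`-side `#Sel^ψ ≤ 125`, tree `KubertTate1314Descent.natCard_selmerGroup_dual_le`)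
gives `Ш(E/ℚ)[5] = 0`. [cite: SilvermanAEC2009, Thm. X.4.2(a) and Prop. X.4.9] [cite: Fisher2001FiveSevenDescent, §2] -/
theorem shaCorank_five_curveE_eq_zero : curveE.shaCorank 5 = 0 :=
  (shaCorank_congr curveE_eq_kubertTateFive 5).trans KubertTate1314Descent.shaCorank_five_eq_zero

/-- **`Ш(E_{13/14}/ℚ)[5] = 0`.** [cite: SilvermanAEC2009, Thm. X.4.2(a)] [cite: Fisher2001FiveSevenDescent, §2] -/
theorem sha_torsionBy_five_curveE_eq_bot : curveE.sha[((5 : ℕ) : ℤ)] = ⊥ :=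
  sha_torsionBy_eq_bot_congr curveE_eq_kubertTateFive _ KubertTate1314Descent.sha_torsionBy_five_eq_bot

/-- **`Ш(E_{13/14}/ℚ)[5^∞] = 0`.** [cite: SilvermanAEC2009, Thm. X.4.2(a)] -/
theorem primaryComponent_sha_five_curveE_eq_bot : AddCommGroup.primaryComponent curveE.sha 5 = ⊥ :=
  primaryComponent_sha_eq_bot_congr curveE_eq_kubertTateFive 5
    KubertTate1314Descent.primaryComponent_sha_five_eq_bot

/-- `Ш(E_{13/14}/ℚ)[5^∞]` is finite. [cite: SilvermanAEC2009, Thm. X.4.2(a)] -/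
theorem finite_primaryComponent_sha_five_curveE : Finite (AddCommGroup.primaryComponent curveE.sha 5) :=
  haveI : Fact (Nat.Prime 5) := ⟨Nat.prime_five⟩
  (finite_primaryComponent_sha_iff_shaCorank_eq_zero curveE 5).2 shaCorank_five_curveE_eq_zero

/-- **`s_5(E_{13/14}) = corank_{ℤ₅} Sel_{5^∞}(E_{13/14}/ℚ) = 2 = rank E_{13/14}(ℚ)`** (`s_p = r + t_p`).
[cite: SilvermanAEC2009, Thm. X.4.2(b)] -/
theorem selmerCorank_five_curveE_eq_two : curveE.selmerCorank 5 = 2 :=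
  (selmerCorank_congr curveE_eq_kubertTateFive 5).trans KubertTate1314Descent.selmerCorank_five_eq_two

/-- **`t_5(E') = 0`** on the isogenous curve `E' = [1, -182, -2548, -306670, -121427670]` (`t_p` is an isogeny
invariant, tree `IsIsogenous.shaCorank_eq`). [cite: MilneADT2006, Ch. I Lemma 7.1(b) (proof), p. 96] -/
theorem shaCorank_five_curveE'_eq_zero : curveE'.shaCorank 5 = 0 := by
  haveI : Fact (Nat.Prime 5) := ⟨Nat.prime_five⟩
  rw [← IsIsogenous.shaCorank_eq ⟨fiveIsogeny⟩ 5]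
  exact shaCorank_five_curveE_eq_zero

/-- **`T` BY NAME AT THE WITNESS PRIME `p₀ = 5`**: granting `FiniteShaComponentTransfer`, `t_q(E_{13/14}) = 0`
for EVERY prime `q` — its hypothesis `t_5(E_{13/14}) = 0` is now a theorem, on a curve of rank `2` where no
result in print gives the finiteness of any other `Ш[q^∞]`. [cite: SilvermanAEC2009, Thm. X.4.2(a)] -/
theorem transfer_at_five (hT : FiniteShaComponentTransfer) (q : ℕ) [Fact q.Prime] : curveE.shaCorank q = 0 :=
  haveI : Fact (Nat.Prime 5) := ⟨Nat.prime_five⟩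
  hT curveE 5 q shaCorank_five_curveE_eq_zero

/-- … and `t_q(E') = 0` for every prime `q` on the isogenous curve. [cite: SilvermanAEC2009, Thm. X.4.2(a)] -/
theorem transfer_at_five_curveE' (hT : FiniteShaComponentTransfer) (q : ℕ) [Fact q.Prime] :
    curveE'.shaCorank q = 0 :=
  haveI : Fact (Nat.Prime 5) := ⟨Nat.prime_five⟩
  hT curveE' 5 q shaCorank_five_curveE'_eq_zero

/-- Under `T`: every `Ш(E_{13/14}/ℚ)[q^∞]` is finite. [cite: SilvermanAEC2009, Thm. X.4.2(a)] -/
theorem finite_primaryComponent_sha_of_transfer (hT : FiniteShaComponentTransfer) (q : ℕ) [Fact q.Prime] :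
    Finite (AddCommGroup.primaryComponent curveE.sha q) :=
  (finite_primaryComponent_sha_iff_shaCorank_eq_zero curveE q).2 (transfer_at_five hT q)

/-- Under `T`: every `s_q(E_{13/14}) = 2 = rank` (`s_q = r + t_q`). [cite: SilvermanAEC2009, Thm. X.4.2(b)] -/
theorem selmerCorank_curveE_eq_two_of_transfer (hT : FiniteShaComponentTransfer) (q : ℕ) [Fact q.Prime] :
    curveE.selmerCorank q = 2 := by
  rw [curveE.selmerCorank_eq_mordellWeilRank_add_holds q, transfer_at_five hT q, add_zero, curveE_eq_kubertTateFive]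
  exact KubertTate1314Descent.mordellWeilRank_eq_two

/-- **The route's `O = OneFiniteShaComponent` holds for `E_{13/14}`, witness `p₀ = 5`, UNCONDITIONALLY** — a rank-`2`
instance of the item X1/`O`. [cite: SilvermanAEC2009, Thm. X.4.2(a)] -/
theorem oneFiniteShaComponent_curveE : ∃ (p : ℕ) (_ : Fact p.Prime), curveE.shaCorank p = 0 :=
  ⟨5, ⟨Nat.prime_five⟩, shaCorank_five_curveE_eq_zero⟩

/-- **Status of the door at `5` after g16 (all unconditional but the last conjunct's hypothesis `T`)**:
`rank E_{13/14}(ℚ) = 2`, `t_5 = 0`, `s_5 = 2`, `Ш[5] = 0`, `t_5(E') = 0`, and `T ⟹ ∀ q, t_q = 0`.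
[cite: SilvermanAEC2009, Thm. X.4.2] [cite: Fisher2001FiveSevenDescent, §2] -/
theorem doorAtFive_open :
    curveE.mordellWeilRank = 2 ∧ curveE.shaCorank 5 = 0 ∧ curveE.selmerCorank 5 = 2 ∧
      curveE.sha[((5 : ℕ) : ℤ)] = ⊥ ∧ curveE'.shaCorank 5 = 0 ∧
      (FiniteShaComponentTransfer → ∀ q : ℕ, [Fact q.Prime] → curveE.shaCorank q = 0) := by
  refine ⟨?_, shaCorank_five_curveE_eq_zero, selmerCorank_five_curveE_eq_two, sha_torsionBy_five_curveE_eq_bot,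
    shaCorank_five_curveE'_eq_zero, fun hT q _ ↦ transfer_at_five hT q⟩
  rw [curveE_eq_kubertTateFive]; exact KubertTate1314Descent.mordellWeilRank_eq_two

end Open

end Summit.BirchSwinnertonDyer.BirchSwinnertonDyer.Theorems.ShaPrimaryTransferDoorAtFiveDual

end
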